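import Summits.BirchSwinnertonDyer.Rank1Residual.ManinAdditive.NeronOmegaThreeFrickeTrace
import Summits.BirchSwinnertonDyer.Rank1Residual.ManinAdditive.ConwayNortonTwistAtThreeProofs
import Literature.NumberTheory.EllipticCurves.DegeneracyTraceCosetSum
import Literature.NumberTheory.EllipticCurves.CuspFormLFunctionFrickeProofs
import HarnessLib

/-!
# `TraceTranslateIdentityAtThree` HOLDS — the degeneracy trace one storey down a 3-tower is `1 + w_N t_{2/3} w_N + w_N t_{1/3} w_N`
# (cell `bsd-f2-manin`, typer g16; discharges the SUPPORT node of `NeronOmegaThreeFrickeTrace.lean`, imc g21 PROOFS-g21 §1 (E2))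

For `N = 3M` with `3 ∣ M` and `y ∈ S₂(Γ₀(N))`:
`degeneracyMap0 M N 1 2 (adjDegeneracyMap0 N M 1 2 y) = y + w_N (t_{2/3} (w_N y)) + w_N (t_{1/3} (w_N y))`
(`w_N = frickeInvolution N 2`, `t_{j/3} = ConwayNortonThree.thirdTranslate N 2 j`).  PROOF (all ingredients in the tree):
(1) the trace is the coset sum `∑_{j<3} y ∣ (1 0; Mj 1)` (Literature `coe_adjDegeneracyMap0_one_three_mul_eq_sum`,
`DegeneracyTraceCosetSum.lean`, Diamond–Shurman §5.1 (3)) and the inclusion `degeneracyMap0 M N 1 2` is the identity on functions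
(`coe_degeneracyMap0_one`); (2) POINTWISE, `(w_N (t_{j/3} (w_N y)))(τ) = (y ∣₂ (1 0; −Mj 1))(τ)` (`fricke_thirdTranslate_fricke_apply`:
`w_N • (j/3 + w_N • τ) = τ/(1 − Mjτ)` and the automorphy factors multiply to `(1 − Mjτ)⁻²`; one-term formulas
`frickeInvolution_apply_eq_slash_holds`, `thirdTranslate_two_apply`), i.e. the matrix identity `w_N (3 j; 0 3) w_N = −3N·(1 0; −Mj 1)` with
the weight-2 scalar triviality; (3) `y ∣ (1 0; −Mj 1) = y ∣ (1 0; (3−j)M 1)` because `(1 0; −N 1) ∈ Γ₀(N)` (`slash_lowerUnipotent_eq_of_dvd_sub`).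
Hence `traceTranslateIdentityAtThree_holds : TraceTranslateIdentityAtThree`.  Theorem-only; BSD is not proved by this; the other five
nodes of `NeronOmegaThreeFrickeTrace.lean` (E-imc-149/159/160a/160b/161) are untouched.
-/

noncomputable section

open scoped MatrixGroups ModularForm
open CongruenceSubgroup UpperHalfPlane Matrix.SpecialLinearGroup
  Literature.NumberTheory.EllipticCurves.ModularForms
  Summit.BirchSwinnertonDyer.Rank1Residual.ManinAdditive
  Summit.BirchSwinnertonDyer.Rank1Residual.ManinAdditive.ConwayNortonThree

namespace Summit.BirchSwinnertonDyer.Rank1Residual.ManinAdditive.NeronOmegaThree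

/-- **`(w_N (t_{j/3} (w_N y)))(τ) = (y ∣₂ (1 0; −Mj 1))(τ)`** for `N = 3M`, `3 ∣ M` (weight 2): the matrix identity
`w_N (3 j; 0 3) w_N = −3N · (1 0; −Mj 1)` read pointwise (`w_N • (j/3 + w_N • τ) = τ/(1 − Mjτ)`, factors `(1 − Mjτ)⁻²`).
[cite: AtkinLehner1970, §4 (normaliser of Γ₀(N)) and Lemma 27] -/
theorem fricke_thirdTranslate_fricke_apply (M : ℕ) [NeZero M] [NeZero (3 * M)] (h3 : 3 ∣ M) (j : ℕ)
    (y : CuspForm (Gamma0 (3 * M)) 2) (τ : ℍ) :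
    frickeInvolution (3 * M) 2 (thirdTranslate (3 * M) 2 j (frickeInvolution (3 * M) 2 y)) τ =
      (⇑y ∣[(2 : ℤ)] (transpose (ModularGroup.T ^ (-((M : ℤ) * j))) : SL(2, ℤ))) τ := by
  have h9 : 9 ∣ 3 * M := by obtain ⟨m, rfl⟩ := h3; exact ⟨m, by ring⟩
  have hN0 : ((3 * M : ℕ) : ℂ) ≠ 0 := by exact_mod_cast NeZero.ne (3 * M)
  have hτ : (τ : ℂ) ≠ 0 := τ.ne_zero
  have hfr := frickeInvolution_apply_eq_slash_holds (3 * M) 2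
  have hc : (((3 * M : ℕ) : ℝ) ^ (1 - ((2 : ℤ) : ℝ) / 2) : ℝ) = 1 := by norm_num
  rw [hfr, hc, Complex.ofReal_one, one_smul, ModularForm.slash_apply, σ_glCast,
    thirdTranslate_two_apply h9, hfr, hc, Complex.ofReal_one, one_smul,
    ModularForm.slash_apply, σ_glCast, det_glCast_frickeGL, ModularForm.SL_slash_apply]
  -- the inner point `τ₁ = j/3 - 1/(Nτ)`
  set τ₁ : ℍ := ((((j : ℤ) : ℝ) / (3 : ℕ) : ℝ)) +ᵥ glCast (frickeGL (3 * M) : GL (Fin 2) ℚ) • τ with hτ₁def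
  have hτ₁ : (τ₁ : ℂ) = (j : ℂ) / 3 - (((3 * M : ℕ) : ℂ) * τ)⁻¹ := by
    rw [hτ₁def, coe_vadd, coe_frickeGL_smul]; push_cast; ring
  have hτ₁0 : (τ₁ : ℂ) ≠ 0 := τ₁.ne_zero
  -- the two points agree: `w_N • τ₁ = (1 0; -Mj 1) • τ`
  have hM0 : (M : ℂ) ≠ 0 := by exact_mod_cast NeZero.ne M
  have hN : ((3 * M : ℕ) : ℂ) = 3 * (M : ℂ) := by push_cast; ring
  have hden2 : ((((-((M : ℤ) * j)) : ℤ) : ℝ) : ℂ) * (τ : ℂ) + (((1 : ℤ) : ℝ) : ℂ) ≠ 0 := by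
    have h := denom_ne_zero (mapGL ℝ (transpose (ModularGroup.T ^ (-((M : ℤ) * j))) : SL(2, ℤ))) τ
    rw [denom, val_mapGL_LU] at h
    simpa using h
  have hA : (-((M : ℂ) * j)) * (τ : ℂ) + 1 ≠ 0 := by push_cast at hden2; exact hden2
  have hB : ((3 * M : ℕ) : ℂ) * ((j : ℂ) / 3 - (((3 * M : ℕ) : ℂ) * τ)⁻¹) ≠ 0 := by
    rw [← hτ₁]; exact mul_ne_zero hN0 hτ₁0
  rw [hN] at hB
  have hA1 : (1 : ℂ) - τ * M * j ≠ 0 := by intro h; apply hA; linear_combination h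
  have hA2 : (-1 : ℂ) + τ * M * j ≠ 0 := by intro h; apply hA; linear_combination -h
  have hP : glCast (frickeGL (3 * M) : GL (Fin 2) ℚ) • τ₁ =
      (transpose (ModularGroup.T ^ (-((M : ℤ) * j))) : SL(2, ℤ)) • τ := by
    apply UpperHalfPlane.ext
    rw [coe_frickeGL_smul, coe_specialLinearGroup_apply, coe_LU, hτ₁, hN]
    simp only [Matrix.of_apply, Matrix.cons_val', Matrix.cons_val_zero, Matrix.cons_val_one,
      Matrix.cons_val_fin_one, eq_intCast]
    push_cast
    field_simp
    rw [add_zero, show ((M : ℂ) * j * τ - 1) = -(-((M : ℂ) * j * τ) + 1) by ring, div_neg, neg_neg]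
  rw [hP, ModularGroup.denom_apply, denom, denom, val_glCast_frickeGL, coe_LU]
  simp only [Matrix.of_apply, Matrix.cons_val', Matrix.cons_val_zero, Matrix.cons_val_one,
    Matrix.cons_val_fin_one, Nat.abs_cast, show (2 : ℤ) - 1 = 1 by norm_num, zpow_neg, zpow_ofNat]
  rw [hτ₁]
  push_cast
  simp only [pow_one, add_zero]
  field_simp
  ring

/-- Slashing a level-`N` form by `(1 0; a 1)` or by `(1 0; b 1)` gives the same function when `N ∣ a − b`
(`(1 0; a−b 1) ∈ Γ₀(N)`). [cite: DiamondShurman2005, §5.1 special case (3) (p. 165)] -/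
theorem slash_lowerUnipotent_eq_of_dvd_sub {N : ℕ} {k : ℤ} (y : CuspForm (Gamma0 N) k) {a b : ℤ} (h : (N : ℤ) ∣ a - b) :
    (⇑y ∣[k] (transpose (ModularGroup.T ^ a) : SL(2, ℤ))) = ⇑y ∣[k] (transpose (ModularGroup.T ^ b) : SL(2, ℤ)) := by
  have hab : (transpose (ModularGroup.T ^ a) : SL(2, ℤ)) =
      transpose (ModularGroup.T ^ (a - b)) * transpose (ModularGroup.T ^ b) := by
    apply Subtype.ext
    rw [Matrix.SpecialLinearGroup.coe_mul, coe_LU, coe_LU, coe_LU]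
    ext i j
    fin_cases i <;> fin_cases j <;> simp [Matrix.mul_apply, Fin.sum_univ_two]
  rw [hab, SlashAction.slash_mul]
  congr 1
  exact SlashInvariantFormClass.slash_action_eq y (mapGL ℝ (transpose (ModularGroup.T ^ (a - b))))
    (Subgroup.mem_map_of_mem _ (LU_mem_gamma0 N h))

/-- **The trace–translate identity** at `N = 3M`, `3 ∣ M`:
`ι (Tr^N_M y) = y + w_N (t_{2/3} (w_N y)) + w_N (t_{1/3} (w_N y))` (coset identity `Γ₀(M) = ⊔ⱼ Γ₀(N)(1 0; Mj 1)`,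
`(1 0; Mj 1) = w_N (1 −j/3; 0 1) w_N⁻¹`; imc PROOFS-g21 §1 (E2)). [cite: DiamondShurman2005, §5.1 special case (3) (p. 165)] -/
theorem traceTranslateIdentity (M : ℕ) [NeZero M] [NeZero (3 * M)] (h3 : 3 ∣ M)
    (y : CuspForm (Gamma0 (3 * M)) 2) :
    degeneracyMap0 M (3 * M) 1 2 (adjDegeneracyMap0 (3 * M) M 1 2 y) =
      y + frickeInvolution (3 * M) 2 (thirdTranslate (3 * M) 2 2 (frickeInvolution (3 * M) 2 y))
        + frickeInvolution (3 * M) 2 (thirdTranslate (3 * M) 2 1 (frickeInvolution (3 * M) 2 y)) := by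
  apply DFunLike.ext
  intro τ
  have hL := congrFun (coe_degeneracyMap0_one M (3 * M) 2 ⟨3, by ring⟩ (adjDegeneracyMap0 (3 * M) M 1 2 y)) τ
  rw [hL, coe_adjDegeneracyMap0_one_three_mul_eq_sum 2 M h3 y, Finset.sum_apply, Fin.sum_univ_three]
  simp only [CuspForm.coe_add, Pi.add_apply, fricke_thirdTranslate_fricke_apply M h3,
    Fin.val_zero, Fin.val_one, Fin.val_two, Nat.cast_zero, Nat.cast_one, Nat.cast_ofNat, mul_zero]
  have h0 : (⇑y ∣[(2 : ℤ)] (mapGL ℝ (transpose (ModularGroup.T ^ (0 : ℤ))) : GL (Fin 2) ℝ)) = ⇑y :=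
    SlashInvariantFormClass.slash_action_eq y _ (Subgroup.mem_map_of_mem _ (LU_mem_gamma0 (3 * M) (dvd_zero _)))
  have h1 : (⇑y ∣[(2 : ℤ)] (transpose (ModularGroup.T ^ (-((M : ℤ) * 2))) : SL(2, ℤ))) =
      ⇑y ∣[(2 : ℤ)] (mapGL ℝ (transpose (ModularGroup.T ^ ((M : ℤ) * 1))) : GL (Fin 2) ℝ) :=
    slash_lowerUnipotent_eq_of_dvd_sub y ⟨-1, by push_cast; ring⟩
  have h2 : (⇑y ∣[(2 : ℤ)] (transpose (ModularGroup.T ^ (-((M : ℤ) * 1))) : SL(2, ℤ))) =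
      ⇑y ∣[(2 : ℤ)] (mapGL ℝ (transpose (ModularGroup.T ^ ((M : ℤ) * 2))) : GL (Fin 2) ℝ) :=
    slash_lowerUnipotent_eq_of_dvd_sub y ⟨-1, by push_cast; ring⟩
  rw [h0, h1, h2]

/-- **`TraceTranslateIdentityAtThree` HOLDS** (the SUPPORT node of `NeronOmegaThreeFrickeTrace.lean`, imc g21). [cite: DiamondShurman2005, §5.1 special case (3) (p. 165)] -/
theorem traceTranslateIdentityAtThree_holds : TraceTranslateIdentityAtThree :=
  fun M _ h3 y => traceTranslateIdentity M h3 y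

end Summit.BirchSwinnertonDyer.Rank1Residual.ManinAdditive.NeronOmegaThree

end
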